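import Mathlib
import Summits.ResolutionOfSingularities.ResolutionOfSingularities.Theorems.WildQuotientsWildQuotientResolutionStubQuotientModelLemmas
import HarnessLib

/-!
# The quotient model `X♯/G → X₁` (crux `WildQuotients.WildQuotientResolution`, line `Sketch`)

Stub `stub_quotientModel` of the skeleton `Sketch` for crux stmt-ResolutionOfSingularities-15640
(route `ResolutionOfSingularities/WildQuotients`, card `p-closure-sylow-separation`): the
classical quotient glue (SGA 1, Exp. V, §1–2; Mumford, *Abelian Varieties*, §7) after Phase 0.
Given the crux data — a finite group `G` acting FAITHFULLY on the integral `X′` over the finite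
`G`-invariant `q : X′ → X₁` (surjective, fibres the orbits, étale over a dense open; `X₁` integral,
separated of finite type over a field `k`) — and a `G`-equivariant proper birational integral
model `π : X♯ → X′` covered by `G`-stable affine opens, we BUILD:

* `Y₁ := X♯/G`, the tree's glued quotient `ActionOver.glued`
  (`Literature.AlgebraicGeometry.RelativeSpec.FiniteGroupQuotientGluing`) for the action over
  `X₁` along `π ≫ q` (the `G`-stable affines are affine over the separated `X₁`), with
  `q♯ = gluedMk : X♯ → Y₁` finite, surjective, `G`-invariant, fibres the orbits
  (`…FiniteGroupQuotientGluedProperties`), étale over a dense open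
  (`…Theorems.WildQuotientsGaloisQuotientEtaleGlued`, the action on `X♯` being faithful because
  `π` is dominant onto the reduced separated `X′`);
* `r := gluedDesc (π ≫ q) : Y₁ → X₁` (categorical quotient), proper (`isProper_gluedDesc`),
  `g := r ≫ f`, so that `Y₁` is separated, locally of finite type and quasi-compact over `k`;
* (`exists_dense_isFinite_etale_bijective`) a dense open `W ⊆ X₁` over which `r` is FINITE,
  ÉTALE and BIJECTIVE: `W` is an affine neighbourhood of the generic point inside the étale
  locus of `q` and under the isomorphism locus `V` of `π`, so that `O = (π ≫ q)⁻¹ W₁` is a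
  `G`-stable affine and `r⁻¹(W₁)` is the chart `O/G`; shrunk (using that `r` is closed and its
  fibre over the generic point is the generic point) so that the action on the sections of `O`
  over it is free — a non-zero invariant section in all augmentation ideals exists by
  faithfulness (`exists_invariant_mem_augIdeal`). Over `W`: finite = proper + affine; étale by
  the ring computation `etale_quotientToBase_app` of the companion file `…StubQuotientModelLemmas`
  (Chase–Harrison–Rosenberg + descent of étaleness along the faithfully flat `O → O/G`);
  injective since the fibres of `q` are orbits and `π` is injective over `V`; surjective since
  `q` and `π|_V` are.
-/

-- single-problem summit: the doubled namespace component `ResolutionOfSingularities` is forced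
set_option linter.dupNamespace false

noncomputable section

namespace Summit.ResolutionOfSingularities.ResolutionOfSingularities.Theorems.WildQuotientResolution.QuotientModel

open CategoryTheory Limits AlgebraicGeometry TopologicalSpace
open Literature.AlgebraicGeometry.Resolution Literature.AlgebraicGeometry.RelativeSpec
open Literature.AlgebraicGeometry.Motives Literature.AlgebraicGeometry.Motives.RatFn

/-! ## The dense open `W ⊆ X₁` over which `X♯/G → X₁` is finite, étale and bijective -/

section WClause

variable {Xs X' X₁ : Scheme.{0}} (π : Xs ⟶ X') (q : X' ⟶ X₁) {G : Type} [Group G] [Finite G]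
  (ρB : ActionOver (π ≫ q) G) [X₁.IsSeparated] [IsSeparated (π ≫ q)] [IsIntegral Xs]
  [IsIntegral X'] [IsIntegral X₁] [IsFinite q] [IsLocallyNoetherian X₁]

set_option maxHeartbeats 400000 in
/-- **The `W`-clause.** For the glued quotient `X♯/G` of `X♯` by `G` acting over `X₁` through
the `G`-equivariant proper birational `π : X♯ → X′` followed by the finite `G`-invariant
`q : X′ → X₁` (surjective, fibres the orbits, étale over a dense open), with `G` acting
faithfully on `X♯`, the descended `r : X♯/G → X₁` is finite, étale and bijective over a dense
open `W ⊆ X₁`. Construction: `W` is an affine neighbourhood of the generic point inside the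
étale locus of `q`, under the isomorphism locus of `π` (so that `O = (π ≫ q)⁻¹ W₁` is a
`G`-stable affine and `r⁻¹ W₁` is the chart `O/G`), and small enough that the action on the
sections of `O` over it is free (an invariant section in all augmentation ideals exists because
the action is faithful; `r` is closed, so opens of `X♯/G` around the generic fibre contain
preimages of opens of `X₁`). Over `W`: finite = proper + affine; étale by
`etale_quotientToBase_app`; injective because the fibres of `q` are orbits and `π` is injective
over `V`, surjective because `q` and `π|_V` are. [cite: SGA1, Exp. V, Prop. 2.6]
[cite: MumfordAV1970, §7 Thm. p. 66] -/
theorem exists_dense_isFinite_etale_bijective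
    (hcov : ∀ x : Xs, ∃ O : ρB.StableAffineOpens, x ∈ O.1)
    (hinj : Function.Injective ρB.aut) (ρ : G →* Aut X')
    (hequiv : ∀ g : G, (ρB.aut g).hom ≫ π = π ≫ (ρ g).hom)
    (horb : ∀ x y : X', q x = q y → ∃ g : G, (ρ g).hom x = y)
    (hsurj : Function.Surjective q)
    (hU : ∃ U : X₁.Opens, Dense (U : Set X₁) ∧ Etale (q ∣_ U)) (hbir : IsBirational π)
    [IsProper (ρB.gluedDesc (π ≫ q) ρB.aut_comp)] :
    ∃ W : X₁.Opens, Dense (W : Set X₁) ∧ IsFinite (ρB.gluedDesc (π ≫ q) ρB.aut_comp ∣_ W) ∧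
      Etale (ρB.gluedDesc (π ≫ q) ρB.aut_comp ∣_ W) ∧
      Function.Bijective (ρB.gluedDesc (π ≫ q) ρB.aut_comp ∣_ W).base := by
  classical
  set r := ρB.gluedDesc (π ≫ q) ρB.aut_comp with hr_def
  set qs := ρB.gluedMk hcov with hqs_def
  have hqr : qs ≫ r = π ≫ q := ρB.gluedMk_gluedDesc hcov (π ≫ q) ρB.aut_comp
  haveI : Xs.IsSeparated := ⟨by rw [← terminal.comp_from (π ≫ q)]; infer_instance⟩
  haveI : Surjective q := ⟨hsurj⟩
  haveI : IsDominant π := hbir.isDominant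
  obtain ⟨V, hVd, -, hViso⟩ := hbir
  haveI := hViso
  obtain ⟨U, hUd, hUet⟩ := hU
  -- generic points
  have hηU : genericPoint X₁ ∈ U :=
    ((genericPoint_spec X₁).mem_open_set_iff U.2).mpr (by simpa using hUd.nonempty)
  have hηV : genericPoint X' ∈ V :=
    ((genericPoint_spec X').mem_open_set_iff V.2).mpr (by simpa using hVd.nonempty)
  have hqfib : ∀ x' : X', q x' = genericPoint X₁ → x' = genericPoint X' := fun x' hx' =>
    eq_genericPoint_of_apply_eq q hx'
  -- Step 1: an affine `W₁ ∋ η` inside the étale locus with `q⁻¹ W₁ ⊆ V`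
  obtain ⟨W₀, hηW₀, hW₀V⟩ := exists_open_preimage_le q q.isClosedMap V
    (fun x' hx' => by rw [hqfib x' hx']; exact hηV)
  obtain ⟨W₁, hW₁aff, hηW₁, hW₁le⟩ :=
    exists_isAffineOpen_mem_and_subset (x := genericPoint X₁) (U := W₀ ⊓ U) ⟨hηW₀, hηU⟩
  have hW₁W₀ : W₁ ≤ W₀ := fun x hx => (hW₁le hx).1
  have hW₁U : W₁ ≤ U := fun x hx => (hW₁le hx).2
  have hW₁V : q ⁻¹ᵁ W₁ ≤ V := (q.preimage_mono hW₁W₀).trans hW₀V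
  -- Step 2: the `G`-stable open `O = (π ≫ q)⁻¹ W₁`, affine since `π` is an iso over `q⁻¹ W₁`
  have hOaff : IsAffineOpen ((π ≫ q) ⁻¹ᵁ W₁) :=
    isAffineOpen_preimage_of_isIso_morphismRestrict π V (hW₁aff.preimage q) hW₁V
  haveI : IsAffine ((π ≫ q) ⁻¹ᵁ W₁ : Xs.Opens) := hOaff
  obtain ⟨O, hO⟩ : ∃ O : ρB.StableAffineOpens, O.1 = (π ≫ q) ⁻¹ᵁ W₁ :=
    ⟨⟨(π ≫ q) ⁻¹ᵁ W₁, fun g => ρB.preimage_preimage g W₁,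
      isAffineHom_of_isAffine_of_isSeparated _⟩, rfl⟩
  have hmemO : ∀ x : Xs, x ∈ O.1 ↔ (π ≫ q) x ∈ W₁ := fun x => by rw [hO]; rfl
  haveI : IsAffine (O.1 : Scheme.{0}) := by rw [hO]; exact hOaff
  -- Step 3: the chart `O/G ↪ X♯/G`, over which `r` is `O/G → X₁`
  set j := ρB.gluedι O with hj_def
  set ρO := ρB.restrict O.1 O.2.1 with hρO_def
  have hjr : j ≫ r = ρO.quotientToBase := ρB.gluedι_gluedDesc_base O
  have hpre : qs ⁻¹ᵁ j.opensRange = O.1 := ρB.preimage_opensRange_gluedι hcov O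
  have hrW₁ : r ⁻¹ᵁ W₁ ≤ j.opensRange := by
    intro y hy
    obtain ⟨x, rfl⟩ := ρB.gluedMk_surjective hcov y
    have hx : x ∈ O.1 := by
      rw [hmemO, ← hqr, Scheme.Hom.comp_apply]
      exact hy
    rw [← hpre] at hx
    exact hx
  -- Step 4: `O → O/G` is a geometric quotient of the integral `O` by a faithful action
  have hηO : genericPoint Xs ∈ O.1 := by
    rw [hmemO, RatFn.genericPoint_eq_of_isDominant (π ≫ q)]
    exact hηW₁
  have hne : (O.1 : Set Xs).Nonempty := ⟨_, hηO⟩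
  haveI : Nonempty (O.1 : Scheme.{0}) := ⟨⟨_, hηO⟩⟩
  haveI : IsIntegral (O.1 : Scheme.{0}) := isIntegral_of_isOpenImmersion O.1.ι
  haveI : (O.1 : Scheme.{0}).IsSeparated := ActionOver.isSeparated_opens O.1
  have hgeo : ρO.IsGeometricQuotient ρO.toQuotient := ρO.isGeometricQuotient_toQuotient
  have hinjO : Function.Injective ρO.aut := injective_restrict_aut ρB hinj O.1 O.2.1 hne
  have hgenO : genericPoint (O.1 : Scheme.{0}) = ⟨genericPoint Xs, hηO⟩ := by
    apply O.1.ι.isOpenEmbedding.injective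
    rw [genericPoint_eq_of_isOpenImmersion O.1.ι]
    rfl
  -- Step 5: an invariant section `b₀ ≠ 0` of `O` with the action free over `Ω = D(a₀)`,
  -- `a₀` the descent of `b₀`
  letI := (ActionOver.mk ρO.aut hgeo.comp_eq).mulSemiringAction (⊤ : ρO.quotient.Opens)
  have htopaff : IsAffineOpen (ρO.toQuotient ⁻¹ᵁ (⊤ : ρO.quotient.Opens)) := isAffineOpen_top _
  have htopne : ((ρO.toQuotient ⁻¹ᵁ (⊤ : ρO.quotient.Opens) : (O.1 : Scheme.{0}).Opens) :
      Set (O.1 : Scheme.{0})).Nonempty := ⟨⟨_, hηO⟩, trivial⟩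
  obtain ⟨b₀, hb0, hinv, hmem⟩ :=
    exists_invariant_mem_augIdeal ρO hgeo.comp_eq hinjO htopaff htopne
  obtain ⟨a₀, ha₀⟩ := hgeo.exists_app_eq ⊤ b₀ (fun g e => hinv g)
  set Ω : ρO.quotient.Opens := ρO.quotient.basicOpen a₀ with hΩ_def
  have hfreeΩ : letI := (ActionOver.mk ρO.aut hgeo.comp_eq).mulSemiringAction Ω;
      ∀ g : G, g ≠ 1 → Ideal.span (Set.range fun b :
        Γ((O.1 : Scheme.{0}), ρO.toQuotient ⁻¹ᵁ Ω) => g • b - b) = ⊤ :=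
    fun g hg => augIdeal_basicOpen_eq_top ρO hgeo.comp_eq a₀ (by rw [ha₀]; exact hmem g hg)
  have hηΩ : ρO.toQuotient (genericPoint (O.1 : Scheme.{0})) ∈ Ω := by
    change genericPoint (O.1 : Scheme.{0}) ∈ ρO.toQuotient ⁻¹ᵁ Ω
    rw [hΩ_def, Scheme.preimage_basicOpen, ha₀]
    have hb : (O.1 : Scheme.{0}).basicOpen b₀ ≠ ⊥ := by
      rw [Ne, basicOpen_eq_bot_iff]
      exact hb0
    exact ((genericPoint_spec (O.1 : Scheme.{0})).mem_open_set_iff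
      ((O.1 : Scheme.{0}).basicOpen b₀).2).mpr
      (by simpa using ((O.1 : Scheme.{0}).basicOpen b₀).ne_bot_iff_nonempty.mp hb)
  -- Step 6: an affine `W ∋ η`, `W ⊆ W₁`, with `r⁻¹ W ⊆ j(Ω)` (`r` is closed and the fibre of
  -- `r` over `η` is the generic point of `X♯/G`, which lies in `j(Ω)`)
  have hfibr : ∀ y : ρB.glued, r y = genericPoint X₁ → y ∈ j ''ᵁ Ω := by
    intro y hy
    obtain ⟨x, rfl⟩ := ρB.gluedMk_surjective hcov y
    have h1 : r (qs x) = q (π x) := by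
      rw [← Scheme.Hom.comp_apply, hqr, Scheme.Hom.comp_apply]
    have h2 : π x = genericPoint X' := hqfib _ (by rw [← h1]; exact hy)
    have h3 : x = genericPoint Xs := by
      refine eq_of_isIso_morphismRestrict π V (x₁ := x) (x₂ := genericPoint Xs) ?_ ?_ ?_
      · change π x ∈ V
        rw [h2]
        exact hηV
      · change π (genericPoint Xs) ∈ V
        rw [RatFn.genericPoint_eq_of_isDominant π]
        exact hηV
      · rw [h2, RatFn.genericPoint_eq_of_isDominant π]
    subst h3
    refine ⟨ρO.toQuotient (genericPoint (O.1 : Scheme.{0})), hηΩ, ?_⟩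
    rw [hgenO]
    exact (ρB.gluedMk_apply hcov O ⟨genericPoint Xs, hηO⟩).symm
  obtain ⟨W₂, hηW₂, hW₂⟩ := exists_open_preimage_le r r.isClosedMap (j ''ᵁ Ω) hfibr
  obtain ⟨W, hWaff, hηW, hWle⟩ :=
    exists_isAffineOpen_mem_and_subset (x := genericPoint X₁) (U := W₁ ⊓ W₂) ⟨hηW₁, hηW₂⟩
  have hWW₁ : W ≤ W₁ := fun x hx => (hWle hx).1
  have hWW₂ : W ≤ W₂ := fun x hx => (hWle hx).2
  have hrW : r ⁻¹ᵁ W ≤ j.opensRange := (r.preimage_mono hWW₁).trans hrW₁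
  have hrWΩ : r ⁻¹ᵁ W ≤ j ''ᵁ Ω := (r.preimage_mono hWW₂).trans hW₂
  have htW : ρO.quotientToBase ⁻¹ᵁ W ≤ Ω := by
    intro z hz
    have h1 : j z ∈ r ⁻¹ᵁ W := by
      change r (j z) ∈ W
      rw [← Scheme.Hom.comp_apply, hjr]
      exact hz
    obtain ⟨z', hz', e⟩ := hrWΩ h1
    rw [← j.isOpenEmbedding.injective e]
    exact hz'
  have hWV : q ⁻¹ᵁ W ≤ V := (q.preimage_mono hWW₁).trans hW₁V
  refine ⟨W, W.2.dense ⟨_, hηW⟩, ?_, ?_, ?_⟩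
  · -- finite: proper, and affine because `O/G → X₁` is
    rw [IsFinite.iff_isProper_and_isAffineHom]
    refine ⟨inferInstance, (morphismRestrict_iff_of_chart @IsAffineHom j r W hrW).mp ?_⟩
    rw [hjr]
    exact IsZariskiLocalAtTarget.restrict (P := @IsAffineHom) inferInstance W
  · -- étale: on the chart this is `O/G → X₁` over the affine `W`, étale by
    -- `etale_quotientToBase_app`
    refine (morphismRestrict_iff_of_chart @Etale j r W hrW).mp ?_
    rw [hjr]
    have key : ∀ W' : X₁.Opens, W' = W → (ρO.quotientToBase.app W').hom.Etale := by
      rintro W' rfl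
      obtain ⟨hs, hsfin⟩ := etale_and_finite_app_comp π q V O.1 W' hWaff hWV
        (by rw [hO]; exact (π ≫ q).preimage_mono hWW₁)
        (morphismRestrict_of_le @Etale q (hWW₁.trans hW₁U) hUet)
      exact etale_quotientToBase_app' ρO W' hWaff hs hsfin
        (fun g hg => augIdeal_eq_top_of_le (ActionOver.mk ρO.aut hgeo.comp_eq) htW (hfreeΩ g hg))
    exact etale_morphismRestrict_of_etale_app hWaff (hWaff.preimage _) key
  · -- bijective on points: the fibres of `q` are orbits and `π` is bijective over `V`
    constructor
    · rintro ⟨y₁, hy₁⟩ ⟨y₂, hy₂⟩ h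
      have h' : r y₁ = r y₂ := by
        have := congrArg Subtype.val h
        rwa [morphismRestrict_base_coe, morphismRestrict_base_coe] at this
      obtain ⟨x₁, rfl⟩ := ρB.gluedMk_surjective hcov y₁
      obtain ⟨x₂, rfl⟩ := ρB.gluedMk_surjective hcov y₂
      have k₁ : r (qs x₁) = q (π x₁) := by
        rw [← Scheme.Hom.comp_apply, hqr, Scheme.Hom.comp_apply]
      have k₂ : r (qs x₂) = q (π x₂) := by
        rw [← Scheme.Hom.comp_apply, hqr, Scheme.Hom.comp_apply]
      have hx₁V : π x₁ ∈ V := hWV (show q (π x₁) ∈ W by rw [← k₁]; exact hy₁)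
      have hx₂V : π x₂ ∈ V := hWV (show q (π x₂) ∈ W by rw [← k₂]; exact hy₂)
      obtain ⟨g, hg⟩ := horb (π x₁) (π x₂) (by rw [← k₁, ← k₂]; exact h')
      have hπg : π ((ρB.aut g).hom x₁) = π x₂ := by
        rw [← Scheme.Hom.comp_apply, hequiv, Scheme.Hom.comp_apply, hg]
      have heq : (ρB.aut g).hom x₁ = x₂ :=
        eq_of_isIso_morphismRestrict π V (show π _ ∈ V by rw [hπg]; exact hx₂V) hx₂V hπg
      apply Subtype.ext
      change qs x₁ = qs x₂
      rw [← heq, ρB.gluedMk_aut_apply]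
    · rintro ⟨w, hw⟩
      obtain ⟨x', hx'⟩ := hsurj w
      have hx'V : x' ∈ V := hWV (show q x' ∈ W by rw [hx']; exact hw)
      obtain ⟨x, -, hπx⟩ := exists_eq_of_isIso_morphismRestrict π V hx'V
      have hrx : r (qs x) = w := by
        rw [← Scheme.Hom.comp_apply, hqr, Scheme.Hom.comp_apply, hπx, hx']
      refine ⟨⟨qs x, show r (qs x) ∈ W by rw [hrx]; exact hw⟩, Subtype.ext ?_⟩
      rw [morphismRestrict_base_coe]
      exact hrx

end WClause

/-! ## The stub -/

/-- STUB `stub_quotientModel` (L, classical — SGA1 V §1–2; in tree: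
`Literature.AlgebraicGeometry.RelativeSpec.FiniteGroupQuotientGluing/GluedProperties/GenericEtale/
Universal`, `…FreeQuotientEtale`). For the crux data with FAITHFUL `ρ` and a `G`-equivariant
proper birational integral model `π : X♯ → X′` with a `G`-stable affine cover: the quotient
`Y₁ := X♯/G`, glued over `X₁` from the quotients of the `G`-stable affines (affine over the
separated `X₁`) — separated, locally of finite type, quasi-compact over `k`, integral — with
`q♯ : X♯ → Y₁` finite, surjective, `G`-invariant, fibres the `G`-orbits, étale over a dense open
(the action on `X♯` is faithful: `ρ♯ g = 1 ⇒ π ≫ ρ g = π ⇒ ρ g = 1`, `π` being dominant onto the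
reduced separated `X′`); the induced `r : Y₁ → X₁` with `q♯ ≫ r = π ≫ q` (categorical quotient)
and `g = r ≫ f`, proper; and a dense open `W ⊆ X₁` over which `r` is finite, étale and bijective
(`exists_dense_isFinite_etale_bijective`). [cite: SGA1, Exp. V, §1–2, Prop. 1.8 and Prop. 2.6]
[cite: MumfordAV1970, §7 Thm. p. 66] -/
theorem stub_quotientModel (p : ℕ) (k : Type) [Field k] [CharP k p]
    (X' X₁ : Scheme.{0}) (f : X₁ ⟶ Spec (.of k)) (q : X' ⟶ X₁) (G : Type) [Group G] [Finite G]
    (ρ : G →* Aut X') (hfaith : Function.Injective ρ)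
    [IsSeparated f] [LocallyOfFiniteType f] [QuasiCompact f] [IsIntegral X₁] [IsIntegral X']
    [IsFinite q] (hsurj : Function.Surjective q.base)
    (hU : ∃ U : X₁.Opens, Dense (U : Set X₁) ∧ Etale (q ∣_ U))
    (hρ : ∀ g : G, (ρ g).hom ≫ q = q)
    (horb : ∀ x y : X', q.base x = q.base y → ∃ g : G, (ρ g).hom.base x = y)
    (Xs : Scheme.{0}) (π : Xs ⟶ X') (ρs : G →* Aut Xs) [IsProper π] (hbir : IsBirational π)
    [IsIntegral Xs] (hequiv : ∀ g : G, (ρs g).hom ≫ π = π ≫ (ρ g).hom)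
    (hcov : ∀ x : Xs, ∃ U : Xs.Opens, IsAffineOpen U ∧ x ∈ U ∧ ∀ g : G, (ρs g).hom ⁻¹ᵁ U = U) :
    ∃ (Y₁ : Scheme.{0}) (g : Y₁ ⟶ Spec (.of k)) (qs : Xs ⟶ Y₁) (r : Y₁ ⟶ X₁),
      IsSeparated g ∧ LocallyOfFiniteType g ∧ QuasiCompact g ∧ IsIntegral Y₁ ∧ IsFinite qs ∧
      Function.Surjective qs.base ∧ (∃ V : Y₁.Opens, Dense (V : Set Y₁) ∧ Etale (qs ∣_ V)) ∧
      (∀ g : G, (ρs g).hom ≫ qs = qs) ∧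
      (∀ x y : Xs, qs.base x = qs.base y → ∃ g : G, (ρs g).hom.base x = y) ∧
      IsProper r ∧ qs ≫ r = π ≫ q ∧ r ≫ f = g ∧
      ∃ W : X₁.Opens, Dense (W : Set X₁) ∧ IsFinite (r ∣_ W) ∧ Etale (r ∣_ W) ∧
        Function.Bijective (r ∣_ W).base := by
  classical
  -- separatedness and noetherianity downstairs
  haveI : X₁.IsSeparated := ⟨by rw [← terminal.comp_from f]; infer_instance⟩
  haveI : X'.IsSeparated := ⟨by rw [← terminal.comp_from (q ≫ f)]; infer_instance⟩
  haveI : IsLocallyNoetherian X₁ := LocallyOfFiniteType.isLocallyNoetherian f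
  -- the action over `X₁` and its cover by `G`-stable opens affine over `X₁`
  let ρB : ActionOver (π ≫ q) G :=
    ⟨ρs, fun g => by rw [← Category.assoc, hequiv g, Category.assoc, hρ g]⟩
  have hcov' : ∀ x : Xs, ∃ O : ρB.StableAffineOpens, x ∈ O.1 := by
    intro x
    obtain ⟨U, hU, hxU, hUst⟩ := hcov x
    haveI : IsAffine U := hU
    exact ⟨⟨U, hUst, isAffineHom_of_isAffine_of_isSeparated _⟩, hxU⟩
  -- the action on `X♯` is faithful: `π` is dominant onto the reduced separated `X′`
  haveI : IsDominant π := hbir.isDominant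
  have hinj : Function.Injective ρB.aut := by
    intro g₁ g₂ h
    rw [← inv_mul_eq_one]
    apply hfaith
    rw [map_one]
    have h1 : ρs (g₁⁻¹ * g₂) = 1 := by
      rw [map_mul, map_inv, inv_mul_eq_one]
      exact h
    have h2 : π ≫ (ρ (g₁⁻¹ * g₂)).hom = π ≫ 𝟙 X' := by
      rw [Category.comp_id, ← hequiv, h1]
      exact Category.id_comp π
    have h3 : (ρ (g₁⁻¹ * g₂)).hom = 𝟙 X' := ext_of_isDominant π h2
    ext : 1
    exact h3
  -- the quotient `Y₁ := X♯/G` over `X₁`, `q♯ : X♯ → Y₁`, `r : Y₁ → X₁`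
  haveI hY₁ : IsIntegral ρB.glued := ρB.isIntegral_glued hcov'
  haveI hr : IsProper (ρB.gluedDesc (π ≫ q) ρB.aut_comp) :=
    ρB.isProper_gluedDesc hcov' (π ≫ q) ρB.aut_comp (𝟙 X₁) (Category.comp_id _)
  have hqr : ρB.gluedMk hcov' ≫ ρB.gluedDesc (π ≫ q) ρB.aut_comp = π ≫ q :=
    ρB.gluedMk_gluedDesc hcov' _ _
  obtain ⟨W, hWd, hWfin, hWet, hWbij⟩ :=
    exists_dense_isFinite_etale_bijective π q ρB hcov' hinj ρ hequiv horb hsurj hU hbir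
  exact ⟨ρB.glued, ρB.gluedDesc (π ≫ q) ρB.aut_comp ≫ f, ρB.gluedMk hcov',
    ρB.gluedDesc (π ≫ q) ρB.aut_comp, inferInstance, inferInstance, inferInstance, hY₁,
    ρB.isFinite_gluedMk hcov', ρB.gluedMk_surjective hcov',
    exists_dense_etale_gluedMk_morphismRestrict ρB hcov' hinj, ρB.aut_hom_gluedMk hcov',
    fun x y hxy => ρB.exists_aut_apply_eq_of_gluedMk_eq hcov' hxy, hr, hqr, rfl, W, hWd, hWfin,
    hWet, hWbij⟩

end Summit.ResolutionOfSingularities.ResolutionOfSingularities.Theorems.WildQuotientResolution.QuotientModel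

end
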